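import Literature.ModelTheory.ExponentialFields.SemialgebraicFreePieces
import Literature.ModelTheory.ExponentialFields.SemialgebraicLensTools
import HarnessLib

/-!
# Certified cuts: locally uniform goodness and index-level witnesses

Topic `Literature/ModelTheory/ExponentialFields` — block B2d₀ of the proof of the
`C¹`-triangulation theorem for compact semialgebraic sets
(`Literature.ModelTheory.ExponentialFields.OhmotoShiota2017_c1Triangulation`, statement of
[OhmotoShiota2017, Thm. 1.1]) along the proof of [Pawlucki2024], specialized to `p = 1`.

[Pawlucki2024, Prop. 2.5] produces capsules `L` with `int L` inside a single member of the cover;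
Lemma 5.1 then treats every capsule of the refined family with ONE case (one member of the cover).
In the laminar rich-cut formulation (blocks B2a–B2c) validity was recorded pointwise
(`RCValid`: every complementary fibre interval lies in some member), which does not by itself give
a member per laminar piece.  This file records the stronger, *certified* form that the construction
actually provides and extracts index-level witnesses from it:

* a **certificate** `(lo, hi, j, O)` asserts `{x} × (lo x, hi x) ⊆ V j` for ALL `x` in the open set
  `O` (lens pieces on `ℝᵐ`, translated ladder pieces on `U_B`); `CValid` asks that every
  complementary interval of the cut family at `x` lie in a certificate interval whose domain
  contains `x`.  Certified validity is monotone under adding cuts and certificates and implies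
  `RCValid`.
* **Local uniformity**: when the certificate endpoints are members of the cut family, the rank
  lemma (block B2c₂) makes the containment persist near `x` on the nondegenerate locus of a sorted
  piece, so the loci `R_{k,j}` ("piece `k` certified in `V j`") are open in `D` and cover the
  nondegenerate locus of piece `k`.
* **Index-level witnesses**: a semialgebraic partition of unity subordinate to `{R_{k,j}}_j`
  subdivides piece `k` into `q` laminar sub-pieces, the `j`-th nonempty only where `R_{k,j}` holds;
  the resulting laminar family has, for every INDEX, a single member of the cover containing all
  its nonempty open fibres (`exists_indexed_laminar`), which is the form consumed by Lemma 5.1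
  (block B5, `CRDerivHyp`).

No named facts are introduced (D-0026).

## References

* [Pawlucki2024] W. Pawłucki, *Strict `C^p`-triangulations — a new approach to
  desingularization*, J. Eur. Math. Soc. 26 (2024), 3863–3909, Prop. 2.5, Remark 2.3, Cor. 2.4,
  Lemma 5.1.
* [OhmotoShiota2017] T. Ohmoto, M. Shiota, *`C¹`-triangulations of semialgebraic sets*,
  J. Topology 10 (2017), Thm. 1.1 (statement only).
-/

noncomputable section

open Set Filter Metric
open _root_.Topology

namespace Literature.ModelTheory.ExponentialFields

open Literature.NumberTheory.Transcendental (IsSemialgebraicFunOn IsSemialgebraicMapOn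
  isSemialgebraicFunOn_iff)

/-! ### Certificates and certified validity -/

section Certs

variable {m q : ℕ}

/-- A **certificate**: the fibre intervals `(lo x, hi x)`, `x ∈ O`, are claimed to lie in `V j`.
[cite: Pawlucki2024, Prop. 2.5 (`int L ⊆ V`)] -/
structure Cert (m q : ℕ) where
  /-- lower endpoint function -/
  lo : (Fin m → ℝ) → ℝ
  /-- upper endpoint function -/
  hi : (Fin m → ℝ) → ℝ
  /-- the member of the cover -/
  j : Fin q
  /-- the (open) domain of validity -/
  O : Set (Fin m → ℝ)

/-- A certificate is **good** for the cover `V` if its domain is open and its claim holds.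
[cite: Pawlucki2024, Prop. 2.5] -/
def Cert.Good (V : Fin q → Set (Fin (m + 1) → ℝ)) (κ : Cert m q) : Prop :=
  IsOpen κ.O ∧ ∀ x ∈ κ.O, ∀ t ∈ Ioo (κ.lo x) (κ.hi x), (Fin.snoc x t : Fin (m + 1) → ℝ) ∈ V κ.j

/-- **Certified validity** of a cut family at `x`: every complementary interval of the cut values in
`[a x, b x]` lies in a certificate interval whose domain contains `x`.
[cite: Pawlucki2024, Prop. 2.5] -/
def CValid (a b : (Fin m → ℝ) → ℝ) (𝒞 : Finset ((Fin m → ℝ) → ℝ)) (𝒦 : Set (Cert m q))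
    (x : Fin m → ℝ) : Prop :=
  a x ≤ b x → ∀ u ∈ rcCutVals a b 𝒞 x, ∀ v ∈ rcCutVals a b 𝒞 x, u < v →
    (∀ w ∈ rcCutVals a b 𝒞 x, w ≤ u ∨ v ≤ w) → ∃ κ ∈ 𝒦, x ∈ κ.O ∧ κ.lo x ≤ u ∧ v ≤ κ.hi x

variable {a b : (Fin m → ℝ) → ℝ} {𝒞 𝒞' : Finset ((Fin m → ℝ) → ℝ)} {𝒦 𝒦' : Set (Cert m q)}
  {V : Fin q → Set (Fin (m + 1) → ℝ)} {x : Fin m → ℝ}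

/-- Certified validity from its defining property on arbitrary sub-intervals of `[a x, b x]`.
[cite: Pawlucki2024, Prop. 2.5] -/
theorem cvalid_of_forall
    (h : ∀ u v, a x ≤ u → v ≤ b x → u < v → (∀ w ∈ rcCutVals a b 𝒞 x, w ≤ u ∨ v ≤ w) →
      ∃ κ ∈ 𝒦, x ∈ κ.O ∧ κ.lo x ≤ u ∧ v ≤ κ.hi x) :
    CValid a b 𝒞 𝒦 x := fun hab u hu v hv hlt hcons =>
  h u v (mem_Icc_of_mem_rcCutVals hab hu).1 (mem_Icc_of_mem_rcCutVals hab hv).2 hlt hcons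

/-- **Certified validity applied to an arbitrary interval free of inner cut values.**
[cite: Pawlucki2024, Prop. 2.5] -/
theorem CValid.cert (hV : CValid a b 𝒞 𝒦 x) {u v : ℝ} (hu : a x ≤ u) (hv : v ≤ b x) (hlt : u < v)
    (hcons : ∀ w ∈ rcCutVals a b 𝒞 x, w ≤ u ∨ v ≤ w) : ∃ κ ∈ 𝒦, x ∈ κ.O ∧ κ.lo x ≤ u ∧ v ≤ κ.hi x := by
  have hab : a x ≤ b x := hu.trans (hlt.le.trans hv)
  have hfin := rcCutVals_finite a b 𝒞 x
  set L : Set ℝ := {w ∈ rcCutVals a b 𝒞 x | w ≤ u}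
  set R : Set ℝ := {w ∈ rcCutVals a b 𝒞 x | v ≤ w}
  obtain ⟨u₀, hu₀, humax⟩ := (hfin.subset (sep_subset _ _)).exists_maximal
    (⟨a x, left_mem_rcCutVals, hu⟩ : L.Nonempty)
  obtain ⟨v₀, hv₀, hvmin⟩ := (hfin.subset (sep_subset _ _)).exists_minimal
    (⟨b x, right_mem_rcCutVals, hv⟩ : R.Nonempty)
  have hlt₀ : u₀ < v₀ := lt_of_le_of_lt hu₀.2 (hlt.trans_le hv₀.2)
  obtain ⟨κ, hκ, hxO, h1, h2⟩ := hV hab u₀ hu₀.1 v₀ hv₀.1 hlt₀ fun w hw => by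
    rcases hcons w hw with hwu | hwv
    · left
      by_contra hlt'
      exact hlt' (humax ⟨hw, hwu⟩ (not_le.1 hlt').le)
    · right
      by_contra hlt'
      exact hlt' (hvmin ⟨hw, hwv⟩ (not_le.1 hlt').le)
  exact ⟨κ, hκ, hxO, h1.trans hu₀.2, hv₀.2.trans h2⟩

/-- **Monotonicity**: more cuts and more certificates keep certified validity (extra cuts are
harmless). [cite: Pawlucki2024, Prop. 2.5] -/
theorem CValid.mono (hV : CValid a b 𝒞 𝒦 x) (h𝒞 : 𝒞 ⊆ 𝒞') (h𝒦 : 𝒦 ⊆ 𝒦') : CValid a b 𝒞' 𝒦' x := by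
  refine cvalid_of_forall fun u v hu hv hlt hcons => ?_
  obtain ⟨κ, hκ, h⟩ := hV.cert hu hv hlt fun w hw => hcons w (rcCutVals_mono h𝒞 hw)
  exact ⟨κ, h𝒦 hκ, h⟩

/-- Certified validity implies validity when the certificates are good. [cite: Pawlucki2024, Prop. 2.5] -/
theorem CValid.rcValid (hV : CValid a b 𝒞 𝒦 x) (hgood : ∀ κ ∈ 𝒦, κ.Good V) : RCValid a b V 𝒞 x := by
  refine rcValid_of_forall fun u v hu hv hlt hcons => ?_
  obtain ⟨κ, hκ, hxO, h1, h2⟩ := hV.cert hu hv hlt hcons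
  exact ⟨κ.j, fun t ht => (hgood κ hκ).2 x hxO t ⟨h1.trans_lt ht.1, ht.2.trans_le h2⟩⟩

/-- Certified validity depends only on the values of the window functions at the point.
[cite: Pawlucki2024, Prop. 2.5] -/
theorem cvalid_congr {a' b' : (Fin m → ℝ) → ℝ} (ha : a x = a' x) (hb : b x = b' x) :
    CValid a b 𝒞 𝒦 x ↔ CValid a' b' 𝒞 𝒦 x := by
  unfold CValid
  have h : rcCutVals a b 𝒞 x = rcCutVals a' b' 𝒞 x := by
    ext w; simp only [rcCutVals, mem_setOf_eq, ha, hb]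
  rw [h, ha, hb]

/-- Degenerate fibres are certified-valid. [cite: Pawlucki2024, Prop. 2.5] -/
theorem cvalid_of_le (h : b x ≤ a x) : CValid a b 𝒞 𝒦 x := by
  intro hab u hu v hv hlt _
  have hu' := mem_Icc_of_mem_rcCutVals hab hu
  have hv' := mem_Icc_of_mem_rcCutVals hab hv
  exact absurd (hu'.1.trans_lt (hlt.trans_le (hv'.2.trans h))) (lt_irrefl _)

/-- A single certificate covering the whole fibre certifies every cut family there.
[cite: Pawlucki2024, Prop. 2.5] -/
theorem cvalid_of_cert {κ : Cert m q} (hκ : κ ∈ 𝒦) (hxO : x ∈ κ.O) (h1 : κ.lo x ≤ a x) (h2 : b x ≤ κ.hi x) :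
    CValid a b 𝒞 𝒦 x :=
  cvalid_of_forall fun _ _ hu hv _ _ => ⟨κ, hκ, hxO, h1.trans hu, hv.trans h2⟩

/-- **Restriction** to a smaller window (same cuts and certificates). [cite: Pawlucki2024, Prop. 2.5] -/
theorem CValid.restrict {a' b' : (Fin m → ℝ) → ℝ} (hV : CValid a b 𝒞 𝒦 x) (ha : a x ≤ a' x)
    (hb : b' x ≤ b x) : CValid a' b' 𝒞 𝒦 x := by
  refine cvalid_of_forall fun u v hu hv hlt hcons => ?_
  refine hV.cert (ha.trans hu) (hv.trans hb) hlt fun w hw => ?_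
  rcases hw with rfl | rfl | ⟨c, hc, rfl, h1, h2⟩
  · exact Or.inl (ha.trans hu)
  · exact Or.inr (hv.trans hb)
  · rcases lt_or_ge (c x) (a' x) with hca | hca
    · exact Or.inl (hca.le.trans hu)
    rcases lt_or_ge (b' x) (c x) with hcb | hcb
    · exact Or.inr (hv.trans hcb.le)
    rcases eq_or_lt_of_le hca with heq | hlt₁
    · exact Or.inl (heq ▸ hu)
    rcases eq_or_lt_of_le hcb with heq | hlt₂
    · exact Or.inr (heq ▸ hv)
    exact hcons _ (mem_rcCutVals_of_mem hc hlt₁ hlt₂)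

/-- **Splitting**: certified validity on the two halves of a window cut at a member `h ∈ 𝒞` gives
certified validity on the window. [cite: Pawlucki2024, Prop. 2.5] -/
theorem CValid.of_split {h : (Fin m → ℝ) → ℝ} (hh : h ∈ 𝒞) (h₁ : CValid a h 𝒞 𝒦 x) (h₂ : CValid h b 𝒞 𝒦 x)
    (hah : a x ≤ h x) (hhb : h x ≤ b x) : CValid a b 𝒞 𝒦 x := by
  refine cvalid_of_forall fun u v hu hv hlt hcons => ?_
  -- `h x` is not strictly inside `(u, v)`
  have hhx : h x ≤ u ∨ v ≤ h x := by
    rcases eq_or_lt_of_le hah with heq | hlt₁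
    · exact Or.inl (heq ▸ hu)
    rcases eq_or_lt_of_le hhb with heq | hlt₂
    · exact Or.inr (heq.symm ▸ hv)
    exact hcons _ (mem_rcCutVals_of_mem hh hlt₁ hlt₂)
  rcases hhx with hle | hle
  · -- `(u, v) ⊆ [h x, b x]`
    refine h₂.cert hle hv hlt fun w hw => ?_
    rcases hw with rfl | rfl | ⟨c, hc, rfl, h1, h2⟩
    · exact Or.inl hle
    · exact Or.inr hv
    · exact hcons _ (mem_rcCutVals_of_mem hc (lt_of_le_of_lt hah h1) h2)
  · refine h₁.cert hu hle hlt fun w hw => ?_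
    rcases hw with rfl | rfl | ⟨c, hc, rfl, h1, h2⟩
    · exact Or.inl hu
    · exact Or.inr hle
    · exact hcons _ (mem_rcCutVals_of_mem hc h1 (lt_of_lt_of_le h2 hhb))

end Certs

/-! ### Persistence for a sorted laminar family (rank lemma) -/

section Persistence

variable {m N : ℕ} {D : Set (Fin m → ℝ)} {a b : (Fin m → ℝ) → ℝ} {c : Fin N → (Fin m → ℝ) → ℝ}

/-- The sorted laminar functions as order statistics. [cite: Pawlucki2024, Cor. 2.4] -/
theorem rcLaminar_eq_sort {k : ℕ} (hk : k < N + 2) (x : Fin m → ℝ) :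
    rcLaminar a b c k x = (fun i => rcFamily a b c i x) (Tuple.sort (fun i => rcFamily a b c i x) ⟨k, hk⟩) := by
  unfold rcLaminar; rw [dif_pos hk]

/-- Continuity within `D` of the clamped family members. [cite: Pawlucki2024, Cor. 2.4] -/
theorem continuousWithinAt_rcFamily' (ha : ContinuousOn a D) (hb : ContinuousOn b D)
    (hc : ∀ i, ContinuousOn (c i) D) {x₀ : Fin m → ℝ} (hx₀ : x₀ ∈ D) (i : Fin (N + 2)) :
    ContinuousWithinAt (rcFamily a b c i) D x₀ := by
  refine Fin.cases ?_ (fun i => Fin.cases ?_ (fun i => ?_) i) i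
  · exact ha x₀ hx₀
  · exact hb x₀ hx₀
  · simp only [rcFamily, Fin.cons_succ]
    unfold rcClampFun
    exact (ha x₀ hx₀).max ((hc i x₀ hx₀).min (hb x₀ hx₀))

/-- The sorted functions lie in the capsule. [cite: Pawlucki2024, Cor. 2.4] -/
theorem rcLaminar_mem_Icc {x : Fin m → ℝ} (hab : a x ≤ b x) (k : ℕ) : rcLaminar a b c k x ∈ Icc (a x) (b x) := by
  refine ⟨?_, ?_⟩
  · rw [← rcLaminar_zero (c := c) hab]; exact rcLaminar_mono hab (Nat.zero_le k)
  · rcases Nat.lt_or_ge k (N + 1) with h | h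
    · rw [← rcLaminar_last (c := c) hab]; exact rcLaminar_mono hab h.le
    · unfold rcLaminar
      split_ifs with hk
      · have : (⟨k, hk⟩ : Fin (N + 2)) = ⟨N + 1, by omega⟩ := by ext; simp; omega
        have h' := rcLaminar_last (a := a) (b := b) (c := c) hab
        unfold rcLaminar at h'
        rw [dif_pos (show N + 1 < N + 2 by omega)] at h'
        rw [this, h']
      · exact le_rfl

/-- A gap forces `k + 1 < N + 2`. [cite: Pawlucki2024, Cor. 2.4] -/
theorem rcLaminar_lt_of_gap {x : Fin m → ℝ} (hab : a x ≤ b x) {k : ℕ}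
    (hgap : rcLaminar a b c k x < rcLaminar a b c (k + 1) x) : k + 1 < N + 2 := by
  by_contra hge
  have h1 : rcLaminar a b c (k + 1) x = b x := by unfold rcLaminar; rw [dif_neg hge]
  have h2 : b x ≤ rcLaminar a b c k x := by
    rcases Nat.lt_or_ge k (N + 1) with h | h
    · omega
    · have := (rcLaminar_mem_Icc (c := c) hab k).2
      rcases Nat.lt_or_ge k (N + 2) with h' | h'
      · have hk : k = N + 1 := by omega
        subst hk; rw [rcLaminar_last hab]
      · unfold rcLaminar; rw [dif_neg (by omega)]
  rw [h1] at hgap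
  exact absurd hgap (not_lt.2 h2)

/-- **Lower persistence** for a member `c j` of the family: `c j x₀ ≤ α_k x₀ < α_{k+1} x₀` implies
`c j x ≤ α_k x` for `x ∈ D` near `x₀`, as long as the gap persists. [cite: Pawlucki2024, Cor. 2.4] -/
theorem eventually_cut_le_rcLaminar (ha : ContinuousOn a D) (hb : ContinuousOn b D) (hc : ∀ i, ContinuousOn (c i) D)
    (hab : ∀ x ∈ D, a x ≤ b x) {k : ℕ} {x₀ : Fin m → ℝ} (hx₀ : x₀ ∈ D)
    (hgap : rcLaminar a b c k x₀ < rcLaminar a b c (k + 1) x₀) (j : Fin N) (hj : c j x₀ ≤ rcLaminar a b c k x₀) :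
    ∀ᶠ x in 𝓝[D] x₀, x ∈ D → rcLaminar a b c k x < rcLaminar a b c (k + 1) x → c j x ≤ rcLaminar a b c k x := by
  have hk1 := rcLaminar_lt_of_gap (hab x₀ hx₀) hgap
  have hk : k < N + 2 := by omega
  have hfam : rcFamily a b c j.succ.succ x₀ ≤ rcLaminar a b c k x₀ := by
    simp only [rcFamily, Fin.cons_succ, rcClampFun]
    exact max_le (rcLaminar_mem_Icc (hab x₀ hx₀) k).1 ((min_le_left _ _).trans hj)
  have hev := eventually_le_sort_apply (S := D) (g := fun i x => rcFamily a b c i x)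
    (fun i => continuousWithinAt_rcFamily' ha hb hc hx₀ i) ⟨k, hk⟩ ⟨k + 1, hk1⟩ rfl
    (by rw [← rcLaminar_eq_sort hk, ← rcLaminar_eq_sort hk1]; exact hgap) (i := j.succ.succ)
    (by rw [← rcLaminar_eq_sort hk]; exact hfam)
  filter_upwards [hev] with x hx' hxD hgapx
  have hx : rcFamily a b c j.succ.succ x ≤ rcLaminar a b c k x := by rw [rcLaminar_eq_sort hk x]; exact hx'
  simp only [rcFamily, Fin.cons_succ, rcClampFun] at hx
  have hαb' : rcLaminar a b c k x < b x := hgapx.trans_le (rcLaminar_mem_Icc (hab x hxD) (k + 1)).2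
  by_contra hlt
  have hlt' := not_le.1 hlt
  have : min (c j x) (b x) ≤ rcLaminar a b c k x := (le_max_right _ _).trans hx
  rcases le_total (c j x) (b x) with h | h
  · rw [min_eq_left h] at this; exact absurd this (not_le.2 hlt')
  · rw [min_eq_right h] at this; exact absurd this (not_le.2 hαb')

/-- **Upper persistence** for a member `c j`: `α_k x₀ < α_{k+1} x₀ ≤ c j x₀` implies
`α_{k+1} x ≤ c j x` for `x ∈ D` near `x₀`, as long as the gap persists. [cite: Pawlucki2024, Cor. 2.4] -/
theorem eventually_rcLaminar_le_cut (ha : ContinuousOn a D) (hb : ContinuousOn b D) (hc : ∀ i, ContinuousOn (c i) D)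
    (hab : ∀ x ∈ D, a x ≤ b x) {k : ℕ} {x₀ : Fin m → ℝ} (hx₀ : x₀ ∈ D)
    (hgap : rcLaminar a b c k x₀ < rcLaminar a b c (k + 1) x₀) (j : Fin N) (hj : rcLaminar a b c (k + 1) x₀ ≤ c j x₀) :
    ∀ᶠ x in 𝓝[D] x₀, x ∈ D → rcLaminar a b c k x < rcLaminar a b c (k + 1) x → rcLaminar a b c (k + 1) x ≤ c j x := by
  have hk1 := rcLaminar_lt_of_gap (hab x₀ hx₀) hgap
  have hk : k < N + 2 := by omega
  have hfam : rcLaminar a b c (k + 1) x₀ ≤ rcFamily a b c j.succ.succ x₀ := by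
    simp only [rcFamily, Fin.cons_succ, rcClampFun]
    exact le_max_of_le_right (le_min hj (rcLaminar_mem_Icc (hab x₀ hx₀) (k + 1)).2)
  have hev := eventually_sort_apply_le (S := D) (g := fun i x => rcFamily a b c i x)
    (fun i => continuousWithinAt_rcFamily' ha hb hc hx₀ i) ⟨k, hk⟩ ⟨k + 1, hk1⟩ rfl
    (by rw [← rcLaminar_eq_sort hk, ← rcLaminar_eq_sort hk1]; exact hgap) (i := j.succ.succ)
    (by rw [← rcLaminar_eq_sort hk1]; exact hfam)
  filter_upwards [hev] with x hx' hxD hgapx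
  have hx : rcLaminar a b c (k + 1) x ≤ rcFamily a b c j.succ.succ x := by rw [rcLaminar_eq_sort hk1 x]; exact hx'
  simp only [rcFamily, Fin.cons_succ, rcClampFun] at hx
  have haα' : a x < rcLaminar a b c (k + 1) x := (rcLaminar_mem_Icc (hab x hxD) k).1.trans_lt hgapx
  rcases le_total (a x) (min (c j x) (b x)) with h | h
  · rw [max_eq_right h] at hx; exact hx.trans (min_le_left _ _)
  · rw [max_eq_left h] at hx; exact absurd hx (not_le.2 haα')

/-- **The gap persists** near a nondegenerate point. [cite: Pawlucki2024, Cor. 2.4] -/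
theorem eventually_gap (ha : ContinuousOn a D) (hb : ContinuousOn b D) (hc : ∀ i, ContinuousOn (c i) D)
    {k : ℕ} {x₀ : Fin m → ℝ} (hx₀ : x₀ ∈ D)
    (hgap : rcLaminar a b c k x₀ < rcLaminar a b c (k + 1) x₀) :
    ∀ᶠ x in 𝓝[D] x₀, rcLaminar a b c k x < rcLaminar a b c (k + 1) x := by
  have h1 := continuousOn_rcLaminar ha hb hc k x₀ hx₀
  have h2 := continuousOn_rcLaminar ha hb hc (k + 1) x₀ hx₀
  exact (h1.prodMk h2 : ContinuousWithinAt _ D x₀).eventually (isOpen_lt continuous_fst continuous_snd |>.mem_nhds hgap)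

open Classical in
/-- The sorted values are cut values of the enumerated family. [cite: Pawlucki2024, Cor. 2.4] -/
theorem rcLaminar_mem_rcCutVals {x : Fin m → ℝ} (hab : a x ≤ b x) (k : ℕ) :
    rcLaminar a b c k x ∈ rcCutVals a b (Finset.univ.image c) x := by
  by_cases hk : k < N + 2
  · obtain ⟨i, hi⟩ := exists_rcLaminar_eq (a := a) (b := b) (c := c) (x := x) hk
    rw [hi]
    refine Fin.cases ?_ (fun i => Fin.cases ?_ (fun j => ?_) i) i
    · exact left_mem_rcCutVals
    · exact right_mem_rcCutVals
    · simp only [rcFamily, Fin.cons_succ, rcClampFun]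
      rcases le_or_gt (c j x) (a x) with h | h
      · rw [max_eq_left ((min_le_left _ _).trans h)]; exact left_mem_rcCutVals
      rcases le_or_gt (b x) (c j x) with h' | h'
      · rw [min_eq_right h', max_eq_right hab]; exact right_mem_rcCutVals
      · rw [min_eq_left h'.le, max_eq_right h.le]
        exact mem_rcCutVals_of_mem (Finset.mem_image.2 ⟨j, Finset.mem_univ _, rfl⟩) h h'
  · have : rcLaminar a b c k x = b x := by unfold rcLaminar; rw [dif_neg hk]
    rw [this]; exact right_mem_rcCutVals

open Classical in
/-- No cut value of the enumerated family lies strictly between consecutive sorted values.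
[cite: Pawlucki2024, Cor. 2.4] -/
theorem rcCutVals_notMem_Ioo_rcLaminar {x : Fin m → ℝ} (hab : a x ≤ b x) (k : ℕ) {w : ℝ}
    (hw : w ∈ rcCutVals a b (Finset.univ.image c) x) :
    w ≤ rcLaminar a b c k x ∨ rcLaminar a b c (k + 1) x ≤ w := by
  have hwfam : ∃ i, w = rcFamily a b c i x := by
    rcases hw with rfl | rfl | ⟨c', hc', rfl, h1, h2⟩
    · exact ⟨0, rcFamily_zero.symm⟩
    · exact ⟨1, rcFamily_one.symm⟩
    · obtain ⟨i, -, rfl⟩ := Finset.mem_image.1 hc'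
      refine ⟨i.succ.succ, ?_⟩
      simp only [rcFamily, Fin.cons_succ, rcClampFun]
      rw [min_eq_left h2.le, max_eq_right h1.le]
  obtain ⟨i, rfl⟩ := hwfam
  have h := rcFamily_notMem_Ioo (c := c) hab k i (x := x)
  rw [Set.mem_Ioo, not_and_or, not_lt, not_lt] at h
  exact h

end Persistence

/-! ### Certified families and the certified loci `R_{k,j}` -/

section Extraction

variable {m q : ℕ}

/-- Data of a **certified cut family**: base, capsule, enumerated cuts, cover and certificates.
[cite: Pawlucki2024, Prop. 2.5] -/
structure CertFamily (m q : ℕ) where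
  /-- the base -/
  D : Set (Fin m → ℝ)
  /-- bottom of the capsule -/
  a : (Fin m → ℝ) → ℝ
  /-- top of the capsule -/
  b : (Fin m → ℝ) → ℝ
  /-- number of cuts -/
  N : ℕ
  /-- the cuts -/
  c : Fin N → (Fin m → ℝ) → ℝ
  /-- the cover -/
  V : Fin q → Set (Fin (m + 1) → ℝ)
  /-- the certificates -/
  𝒦 : Set (Cert m q)

open Classical in
/-- Hypotheses on a certified family. [cite: Pawlucki2024, Prop. 2.5] -/
structure CertFamily.Hyp (F : CertFamily m q) : Prop where
  D_closed : IsClosed F.D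
  a_cont : ContinuousOn F.a F.D
  b_cont : ContinuousOn F.b F.D
  c_cont : ∀ i, ContinuousOn (F.c i) F.D
  a_le_b : ∀ x ∈ F.D, F.a x ≤ F.b x
  good : ∀ κ ∈ F.𝒦, κ.Good F.V
  lo_mem : ∀ κ ∈ F.𝒦, κ.lo = F.a ∨ κ.lo = F.b ∨ ∃ i, κ.lo = F.c i
  hi_mem : ∀ κ ∈ F.𝒦, κ.hi = F.a ∨ κ.hi = F.b ∨ ∃ i, κ.hi = F.c i
  valid : ∀ x ∈ F.D, CValid F.a F.b (Finset.univ.image F.c) F.𝒦 x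
  q_pos : 0 < q

/-- Semialgebraicity hypotheses on a certified family. [cite: Pawlucki2024, Prop. 2.5] -/
structure CertFamily.SA (F : CertFamily m q) : Prop where
  D_sa : IsSemialgebraic ℝ F.D
  a_sa : IsSemialgebraicFunOn ℝ F.D F.a
  b_sa : IsSemialgebraicFunOn ℝ F.D F.b
  c_sa : ∀ i, IsSemialgebraicFunOn ℝ F.D (F.c i)
  O_sa : ∀ κ ∈ F.𝒦, IsSemialgebraic ℝ κ.O
  𝒦_fin : F.𝒦.Finite

namespace CertFamily

variable (F : CertFamily m q)

/-- The sorted laminar family. [cite: Pawlucki2024, Cor. 2.4] -/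
def α (k : ℕ) : (Fin m → ℝ) → ℝ := rcLaminar F.a F.b F.c k

/-- The certified locus `R_{k,j}`: piece `k` nondegenerate and certified inside `V j`.
[cite: Pawlucki2024, Prop. 2.5 (`int L ⊆ V`)] -/
def R (k : ℕ) (j : Fin q) : Set (Fin m → ℝ) :=
  {x | x ∈ F.D ∧ F.α k x < F.α (k + 1) x ∧
    ∃ κ ∈ F.𝒦, κ.j = j ∧ x ∈ κ.O ∧ κ.lo x ≤ F.α k x ∧ F.α (k + 1) x ≤ κ.hi x}

variable {F} (H : F.Hyp)
include H

/-- `α` is monotone. [cite: Pawlucki2024, Cor. 2.4] -/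
theorem α_mono {x : Fin m → ℝ} (hx : x ∈ F.D) : Monotone fun k => F.α k x := rcLaminar_mono (H.a_le_b x hx)

/-- `α 0 = a`. [cite: Pawlucki2024, Cor. 2.4] -/
theorem α_zero {x : Fin m → ℝ} (hx : x ∈ F.D) : F.α 0 x = F.a x := rcLaminar_zero (H.a_le_b x hx)

/-- `α k = b` for `k ≥ N + 1`. [cite: Pawlucki2024, Cor. 2.4] -/
theorem α_last {x : Fin m → ℝ} (hx : x ∈ F.D) {k : ℕ} (hk : F.N + 1 ≤ k) : F.α k x = F.b x := by
  rcases Nat.lt_or_ge k (F.N + 2) with h | h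
  · have : k = F.N + 1 := by omega
    subst this; exact rcLaminar_last (H.a_le_b x hx)
  · unfold α rcLaminar; rw [dif_neg (by omega)]

/-- `α k ∈ [a, b]`. [cite: Pawlucki2024, Cor. 2.4] -/
theorem α_mem {x : Fin m → ℝ} (hx : x ∈ F.D) (k : ℕ) : F.α k x ∈ Icc (F.a x) (F.b x) :=
  rcLaminar_mem_Icc (H.a_le_b x hx) k

/-- Continuity of `α k` on `D`. [cite: Pawlucki2024, Remark 2.2] -/
theorem continuousOn_α (k : ℕ) : ContinuousOn (F.α k) F.D := continuousOn_rcLaminar H.a_cont H.b_cont H.c_cont k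

/-- **The certified loci cover the nondegenerate locus.** [cite: Pawlucki2024, Prop. 2.5] -/
theorem exists_mem_R {k : ℕ} {x : Fin m → ℝ} (hx : x ∈ F.D) (hgap : F.α k x < F.α (k + 1) x) : ∃ j, x ∈ F.R k j := by
  have hab := H.a_le_b x hx
  obtain ⟨κ, hκ, hxO, h1, h2⟩ := H.valid x hx hab _ (rcLaminar_mem_rcCutVals hab k) _
    (rcLaminar_mem_rcCutVals hab (k + 1)) hgap fun w hw => rcCutVals_notMem_Ioo_rcLaminar hab k hw
  exact ⟨κ.j, hx, hgap, κ, hκ, rfl, hxO, h1, h2⟩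

/-- Persistence of `lo ≤ α k` for a certificate endpoint. [cite: Pawlucki2024, Cor. 2.4] -/
theorem eventually_lo_le {k : ℕ} {x₀ : Fin m → ℝ} (hx₀ : x₀ ∈ F.D) (hgap : F.α k x₀ < F.α (k + 1) x₀)
    {κ : Cert m q} (hκ : κ ∈ F.𝒦) (h : κ.lo x₀ ≤ F.α k x₀) :
    ∀ᶠ x in 𝓝[F.D] x₀, x ∈ F.D → F.α k x < F.α (k + 1) x → κ.lo x ≤ F.α k x := by
  rcases H.lo_mem κ hκ with he | he | ⟨i, he⟩
  · rw [he]; exact Eventually.of_forall fun x hx _ => (α_mem H hx k).1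
  · rw [he] at h
    exact absurd ((α_mem H hx₀ (k + 1)).2.trans h) (not_le.2 hgap)
  · rw [he] at h ⊢
    exact eventually_cut_le_rcLaminar H.a_cont H.b_cont H.c_cont H.a_le_b hx₀ hgap i h

/-- Persistence of `α (k+1) ≤ hi` for a certificate endpoint. [cite: Pawlucki2024, Cor. 2.4] -/
theorem eventually_le_hi {k : ℕ} {x₀ : Fin m → ℝ} (hx₀ : x₀ ∈ F.D) (hgap : F.α k x₀ < F.α (k + 1) x₀)
    {κ : Cert m q} (hκ : κ ∈ F.𝒦) (h : F.α (k + 1) x₀ ≤ κ.hi x₀) :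
    ∀ᶠ x in 𝓝[F.D] x₀, x ∈ F.D → F.α k x < F.α (k + 1) x → F.α (k + 1) x ≤ κ.hi x := by
  rcases H.hi_mem κ hκ with he | he | ⟨i, he⟩
  · rw [he] at h
    exact absurd (h.trans (α_mem H hx₀ k).1) (not_le.2 hgap)
  · rw [he]; exact Eventually.of_forall fun x hx _ => (α_mem H hx (k + 1)).2
  · rw [he] at h ⊢
    exact eventually_rcLaminar_le_cut H.a_cont H.b_cont H.c_cont H.a_le_b hx₀ hgap i h

/-- **Local uniformity: the certified loci are open in `D`.** [cite: Pawlucki2024, Prop. 2.5] -/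
theorem eventually_mem_R {k : ℕ} {j : Fin q} {x₀ : Fin m → ℝ} (hx₀ : x₀ ∈ F.R k j) :
    ∀ᶠ x in 𝓝[F.D] x₀, x ∈ F.R k j := by
  obtain ⟨hxD, hgap, κ, hκ, hj, hxO, h1, h2⟩ := hx₀
  have e1 := eventually_lo_le H hxD hgap hκ h1
  have e2 := eventually_le_hi H hxD hgap hκ h2
  have e3 := eventually_gap H.a_cont H.b_cont H.c_cont hxD hgap
  have e4 : ∀ᶠ x in 𝓝[F.D] x₀, x ∈ κ.O := mem_nhdsWithin_of_mem_nhds ((H.good κ hκ).1.mem_nhds hxO)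
  have e5 : ∀ᶠ x in 𝓝[F.D] x₀, x ∈ F.D := self_mem_nhdsWithin
  filter_upwards [e1, e2, e3, e4, e5] with x hx1 hx2 hx3 hx4 hx5
  exact ⟨hx5, hx3, κ, hκ, hj, hx4, hx1 hx5 hx3, hx2 hx5 hx3⟩

omit H in
/-- A subset of `D` which is a `𝓝[D]`-neighbourhood of each of its points is the trace of an open set.
[folklore] -/
theorem exists_isOpen_inter_of_forall_eventually {S D : Set (Fin m → ℝ)} (hSD : S ⊆ D)
    (h : ∀ x ∈ S, ∀ᶠ y in 𝓝[D] x, y ∈ S) : ∃ W : Set (Fin m → ℝ), IsOpen W ∧ S = D ∩ W := by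
  have hW : ∀ x ∈ S, ∃ U : Set (Fin m → ℝ), IsOpen U ∧ x ∈ U ∧ U ∩ D ⊆ S := by
    intro x hx
    obtain ⟨U, hU, hxU, hsub⟩ := mem_nhdsWithin.1 (h x hx)
    exact ⟨U, hU, hxU, hsub⟩
  choose! U hUo hxU hUsub using hW
  refine ⟨⋃ x ∈ S, U x, isOpen_biUnion fun x hx => hUo x hx, ?_⟩
  ext y
  constructor
  · intro hy
    exact ⟨hSD hy, mem_iUnion₂.2 ⟨y, hy, hxU y hy⟩⟩
  · rintro ⟨hyD, hy⟩
    obtain ⟨x, hx, hyU⟩ := mem_iUnion₂.1 hy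
    exact hUsub x hx ⟨hyU, hyD⟩

/-- `D ∖ R_{k,j}` is closed. [cite: Pawlucki2024, Prop. 2.5] -/
theorem isClosed_diff_R (k : ℕ) (j : Fin q) : IsClosed (F.D \ F.R k j) := by
  obtain ⟨W, hW, hRW⟩ := exists_isOpen_inter_of_forall_eventually (fun x (hx : x ∈ F.R k j) => hx.1)
    (fun x hx => eventually_mem_R H hx)
  have : F.D \ F.R k j = F.D ∩ Wᶜ := by
    rw [hRW]; ext x; simp only [Set.mem_sdiff, mem_inter_iff, mem_compl_iff]; tauto
  rw [this]
  exact H.D_closed.inter hW.isClosed_compl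

/-! #### The partition of unity -/

/-- Distance to `D ∖ R_{k,j}` (`1` if empty). [cite: Pawlucki2024, Prop. 2.5] -/
def dR (k : ℕ) (j : Fin q) (x : Fin m → ℝ) : ℝ := by
  classical
  exact if (F.D \ F.R k j).Nonempty then infDist x (F.D \ F.R k j) else 1

omit H in
/-- `dR ≥ 0`. [cite: Pawlucki2024, Prop. 2.5] -/
theorem dR_nonneg (k : ℕ) (j : Fin q) (x : Fin m → ℝ) : 0 ≤ F.dR k j x := by
  unfold dR; split_ifs
  · exact infDist_nonneg
  · exact zero_le_one

omit H in
/-- `dR` is continuous. [cite: Pawlucki2024, Prop. 2.5] -/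
theorem continuous_dR (k : ℕ) (j : Fin q) : Continuous (F.dR k j) := by
  unfold dR; split_ifs
  · exact continuous_infDist_pt _
  · exact continuous_const

/-- On `D`, `dR_{k,j} > 0` exactly on `R_{k,j}`. [cite: Pawlucki2024, Prop. 2.5] -/
theorem dR_pos_iff {k : ℕ} {j : Fin q} {x : Fin m → ℝ} (hx : x ∈ F.D) : 0 < F.dR k j x ↔ x ∈ F.R k j := by
  unfold dR
  split_ifs with hne
  · rw [← (isClosed_diff_R H k j).notMem_iff_infDist_pos hne]
    simp only [Set.mem_sdiff, not_and, not_not]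
    exact ⟨fun h => h hx, fun h _ => h⟩
  · rw [not_nonempty_iff_eq_empty, Set.sdiff_eq_empty] at hne
    exact ⟨fun _ => hne hx, fun _ => one_pos⟩

/-- The total weight `s_k = Σ_j dR_{k,j}`. [cite: Pawlucki2024, Prop. 2.5] -/
def sR (k : ℕ) (x : Fin m → ℝ) : ℝ := ∑ j : Fin q, F.dR k j x

/-- `s_k > 0` on the nondegenerate locus. [cite: Pawlucki2024, Prop. 2.5] -/
theorem sR_pos {k : ℕ} {x : Fin m → ℝ} (hx : x ∈ F.D) (hgap : F.α k x < F.α (k + 1) x) : 0 < F.sR k x := by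
  obtain ⟨j, hj⟩ := exists_mem_R H hx hgap
  unfold sR
  refine lt_of_lt_of_le ((dR_pos_iff H hx).2 hj) ?_
  exact Finset.single_le_sum (f := fun j => F.dR k j x) (fun j _ => dR_nonneg (F := F) k j x) (Finset.mem_univ j)

omit H in
/-- `s_k` is continuous. [cite: Pawlucki2024, Prop. 2.5] -/
theorem continuous_sR (k : ℕ) : Continuous (F.sR k) := by
  unfold sR; exact continuous_finsetSum _ fun j _ => continuous_dR (F := F) k j

/-- The cumulative weight `Λ_{k,j} = (Σ_{j' < j} dR_{k,j'}) / s_k`. [cite: Pawlucki2024, Prop. 2.5] -/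
def Λ (k j : ℕ) (x : Fin m → ℝ) : ℝ :=
  (∑ j' ∈ Finset.univ.filter (fun j' : Fin q => (j' : ℕ) < j), F.dR k j' x) / F.sR k x

omit H in
/-- `Λ_{k,0} = 0`. [cite: Pawlucki2024, Prop. 2.5] -/
theorem Λ_zero (k : ℕ) (x : Fin m → ℝ) : F.Λ k 0 x = 0 := by
  unfold Λ
  have : Finset.univ.filter (fun j' : Fin q => (j' : ℕ) < 0) = ∅ := by
    ext j; simp
  rw [this, Finset.sum_empty, zero_div]

/-- `Λ_{k,q} = 1` on the nondegenerate locus. [cite: Pawlucki2024, Prop. 2.5] -/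
theorem Λ_top {k : ℕ} {x : Fin m → ℝ} (hx : x ∈ F.D) (hgap : F.α k x < F.α (k + 1) x) : F.Λ k q x = 1 := by
  unfold Λ
  have : Finset.univ.filter (fun j' : Fin q => (j' : ℕ) < q) = Finset.univ := by
    ext j; simp
  rw [this]
  exact div_self (sR_pos H hx hgap).ne'

omit H in
/-- `Λ_{k,j}` is monotone in `j`. [cite: Pawlucki2024, Prop. 2.5] -/
theorem Λ_mono (k : ℕ) (x : Fin m → ℝ) (hs : 0 ≤ F.sR k x) : Monotone fun j => F.Λ k j x := by
  intro j j' hjj'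
  unfold Λ
  refine div_le_div_of_nonneg_right ?_ hs
  refine Finset.sum_le_sum_of_subset_of_nonneg (fun i hi => ?_) fun i _ _ => dR_nonneg (F := F) k i x
  simp only [Finset.mem_filter, Finset.mem_univ, true_and] at hi ⊢
  omega

omit H in
/-- `Λ_{k,j+1} = Λ_{k,j} + dR_{k,j}/s_k` for `j < q`. [cite: Pawlucki2024, Prop. 2.5] -/
theorem Λ_succ (k : ℕ) {j : ℕ} (hj : j < q) (x : Fin m → ℝ) :
    F.Λ k (j + 1) x = F.Λ k j x + F.dR k ⟨j, hj⟩ x / F.sR k x := by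
  unfold Λ
  rw [← add_div]
  congr 1
  have : Finset.univ.filter (fun j' : Fin q => (j' : ℕ) < j + 1) =
      insert ⟨j, hj⟩ (Finset.univ.filter (fun j' : Fin q => (j' : ℕ) < j)) := by
    ext i
    simp only [Finset.mem_filter, Finset.mem_univ, true_and, Finset.mem_insert, Fin.ext_iff]
    omega
  rw [this, Finset.sum_insert, add_comm]
  simp

omit H in
/-- `s_k ≥ 0`. [cite: Pawlucki2024, Prop. 2.5] -/
theorem sR_nonneg (k : ℕ) (x : Fin m → ℝ) : 0 ≤ F.sR k x := Finset.sum_nonneg fun j _ => dR_nonneg (F := F) k j x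

/-! #### The sub-refinement `cc_{k,j}` and the indexed laminar family -/

/-- Clamp to `[0, 1]`. [folklore] -/
def clamp01 (t : ℝ) : ℝ := max 0 (min t 1)

omit H in
/-- `clamp01 t ∈ [0, 1]`. [folklore] -/
theorem clamp01_mem (t : ℝ) : clamp01 t ∈ Icc (0 : ℝ) 1 :=
  ⟨le_max_left _ _, max_le zero_le_one (min_le_right _ _)⟩

omit H in
/-- `clamp01` is monotone. [folklore] -/
theorem clamp01_mono : Monotone clamp01 := fun _ _ h => max_le_max le_rfl (min_le_min h le_rfl)

omit H in
/-- `clamp01` is continuous. [folklore] -/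
theorem continuous_clamp01 : Continuous clamp01 := continuous_const.max (continuous_id.min continuous_const)

omit H in
/-- `clamp01 0 = 0`, `clamp01 1 = 1`. [folklore] -/
theorem clamp01_zero : clamp01 0 = 0 := by simp [clamp01]

omit H in
/-- `clamp01 1 = 1`. [folklore] -/
theorem clamp01_one : clamp01 1 = 1 := by simp [clamp01]

/-- **The sub-refinement** `cc_{k,j} = α_k + clamp01 (Λ_{k,j}) (α_{k+1} - α_k)`.
[cite: Pawlucki2024, Prop. 2.5, Remark 2.3] -/
def cc (k j : ℕ) (x : Fin m → ℝ) : ℝ := F.α k x + clamp01 (F.Λ k j x) * (F.α (k + 1) x - F.α k x)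

/-- `cc_{k,j} ∈ [α_k, α_{k+1}]` on `D`. [cite: Pawlucki2024, Prop. 2.5] -/
theorem cc_mem {x : Fin m → ℝ} (hx : x ∈ F.D) (k j : ℕ) : F.cc k j x ∈ Icc (F.α k x) (F.α (k + 1) x) := by
  have hgap : 0 ≤ F.α (k + 1) x - F.α k x := sub_nonneg.2 (α_mono H hx (Nat.le_succ k))
  have hc := clamp01_mem (F.Λ k j x)
  unfold cc
  constructor <;> nlinarith [hc.1, hc.2]

omit H in
/-- `cc_{k,0} = α_k`. [cite: Pawlucki2024, Prop. 2.5] -/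
theorem cc_zero (k : ℕ) (x : Fin m → ℝ) : F.cc k 0 x = F.α k x := by
  unfold cc; rw [Λ_zero, clamp01_zero, zero_mul, add_zero]

/-- `cc_{k,q} = α_{k+1}` on `D`. [cite: Pawlucki2024, Prop. 2.5] -/
theorem cc_top {x : Fin m → ℝ} (hx : x ∈ F.D) (k : ℕ) : F.cc k q x = F.α (k + 1) x := by
  have hle : F.α k x ≤ F.α (k + 1) x := α_mono H hx (Nat.le_succ k)
  rcases eq_or_lt_of_le hle with heq | hgap
  · have h := cc_mem H hx k q
    rw [← heq] at h ⊢
    exact le_antisymm h.2 h.1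
  · unfold cc; rw [Λ_top H hx hgap, clamp01_one, one_mul]; ring

/-- `cc_{k,j}` is monotone in `j` on `D`. [cite: Pawlucki2024, Prop. 2.5] -/
theorem cc_mono_j {x : Fin m → ℝ} (hx : x ∈ F.D) (k : ℕ) : Monotone fun j => F.cc k j x := by
  intro j j' hjj'
  have hgap : 0 ≤ F.α (k + 1) x - F.α k x := sub_nonneg.2 (α_mono H hx (Nat.le_succ k))
  have h := clamp01_mono (Λ_mono (F := F) k x (sR_nonneg (F := F) k x) hjj')
  unfold cc
  nlinarith

/-- **A nondegenerate sub-piece lies in the certified locus of its index.** [cite: Pawlucki2024, Prop. 2.5] -/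
theorem mem_R_of_cc_lt {x : Fin m → ℝ} (hx : x ∈ F.D) {k j : ℕ} (hj : j < q) (hlt : F.cc k j x < F.cc k (j + 1) x) :
    x ∈ F.R k ⟨j, hj⟩ := by
  have hgap : F.α k x < F.α (k + 1) x := by
    have hle : F.α k x ≤ F.α (k + 1) x := α_mono H hx (Nat.le_succ k)
    rcases eq_or_lt_of_le hle with heq | hgap
    · have h1 := cc_mem H hx k j
      have h2 := cc_mem H hx k (j + 1)
      rw [← heq] at h1 h2
      have e1 := le_antisymm h1.2 h1.1
      have e2 := le_antisymm h2.2 h2.1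
      rw [e1, e2] at hlt
      exact absurd hlt (lt_irrefl _)
    · exact hgap
  by_contra hR
  have hd : F.dR k ⟨j, hj⟩ x = 0 := by
    have h1 := dR_nonneg (F := F) k ⟨j, hj⟩ x
    have h2 : ¬ 0 < F.dR k ⟨j, hj⟩ x := fun h => hR ((dR_pos_iff H hx).1 h)
    linarith [not_lt.1 h2]
  have hΛ : F.Λ k (j + 1) x = F.Λ k j x := by rw [Λ_succ (F := F) k hj, hd, zero_div, add_zero]
  unfold cc at hlt
  rw [hΛ] at hlt
  exact absurd hlt (lt_irrefl _)

/-- **Continuity of `cc_{k,j}` on `D`.** [cite: Pawlucki2024, Remark 2.2] -/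
theorem continuousOn_cc (k j : ℕ) : ContinuousOn (F.cc k j) F.D := by
  intro x₀ hx₀
  have hle : F.α k x₀ ≤ F.α (k + 1) x₀ := α_mono H hx₀ (Nat.le_succ k)
  rcases eq_or_lt_of_le hle with heq | hgap
  · -- squeeze between `α k` and `α (k+1)`
    have h0 : F.cc k j x₀ = F.α k x₀ := by
      have h := cc_mem H hx₀ k j
      rw [← heq] at h; exact le_antisymm h.2 h.1
    have h1 : Tendsto (F.α k) (𝓝[F.D] x₀) (𝓝 (F.α k x₀)) := continuousOn_α H k x₀ hx₀
    have h2 : Tendsto (F.α (k + 1)) (𝓝[F.D] x₀) (𝓝 (F.α k x₀)) := by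
      have := continuousOn_α H (k + 1) x₀ hx₀
      rw [ContinuousWithinAt, ← heq] at this; exact this
    show Tendsto (F.cc k j) (𝓝[F.D] x₀) (𝓝 (F.cc k j x₀))
    rw [h0]
    refine tendsto_of_tendsto_of_tendsto_of_le_of_le' h1 h2 ?_ ?_
    · filter_upwards [self_mem_nhdsWithin] with x hx using (cc_mem H hx k j).1
    · filter_upwards [self_mem_nhdsWithin] with x hx using (cc_mem H hx k j).2
  · -- all ingredients are continuous within `D` at `x₀`, and `s_k x₀ ≠ 0`
    have hs := (sR_pos H hx₀ hgap).ne'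
    have hΛ : ContinuousWithinAt (F.Λ k j) F.D x₀ := by
      unfold Λ
      refine ContinuousWithinAt.div ?_ (continuous_sR (F := F) k).continuousWithinAt hs
      exact (continuous_finsetSum _ fun j' _ => continuous_dR (F := F) k j').continuousWithinAt
    unfold cc
    exact (continuousOn_α H k x₀ hx₀).add ((continuous_clamp01.continuousWithinAt.comp hΛ (mapsTo_univ _ _)).mul
      ((continuousOn_α H (k + 1) x₀ hx₀).sub (continuousOn_α H k x₀ hx₀)))

/-! #### Semialgebraicity -/

variable (S : F.SA)
include S

omit H in
/-- `α k` is semialgebraic on `D`. [cite: Pawlucki2024, Cor. 2.4] -/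
theorem α_sa (k : ℕ) : IsSemialgebraicFunOn ℝ F.D (F.α k) :=
  isSemialgebraicFunOn_rcLaminar S.D_sa S.a_sa S.b_sa S.c_sa k

omit H in
/-- Certificate endpoints are semialgebraic on `D`. [cite: Pawlucki2024, Prop. 2.5] -/
theorem lo_sa (H : F.Hyp) {κ : Cert m q} (hκ : κ ∈ F.𝒦) : IsSemialgebraicFunOn ℝ F.D κ.lo := by
  rcases H.lo_mem κ hκ with h | h | ⟨i, h⟩ <;> rw [h]
  · exact S.a_sa
  · exact S.b_sa
  · exact S.c_sa i

omit H in
/-- Certificate endpoints are semialgebraic on `D`. [cite: Pawlucki2024, Prop. 2.5] -/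
theorem hi_sa (H : F.Hyp) {κ : Cert m q} (hκ : κ ∈ F.𝒦) : IsSemialgebraicFunOn ℝ F.D κ.hi := by
  rcases H.hi_mem κ hκ with h | h | ⟨i, h⟩ <;> rw [h]
  · exact S.a_sa
  · exact S.b_sa
  · exact S.c_sa i

/-- **The certified loci are semialgebraic.** [cite: Pawlucki2024, Prop. 2.5] -/
theorem R_sa (k : ℕ) (j : Fin q) : IsSemialgebraic ℝ (F.R k j) := by
  classical
  set 𝒦j := S.𝒦_fin.toFinset.filter (fun κ => κ.j = j) with h𝒦j
  have h : F.R k j = ⋃ κ ∈ 𝒦j, ({x | x ∈ F.D ∧ F.α k x < F.α (k + 1) x} ∩ κ.O ∩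
      ({x | x ∈ F.D ∧ κ.lo x ≤ F.α k x} ∩ {x | x ∈ F.D ∧ F.α (k + 1) x ≤ κ.hi x})) := by
    ext x
    simp only [R, mem_setOf_eq, mem_iUnion, mem_inter_iff, h𝒦j, Finset.mem_filter, Set.Finite.mem_toFinset,
      exists_prop]
    constructor
    · rintro ⟨hxD, hgap, κ, hκ, hj, hxO, h1, h2⟩
      exact ⟨κ, ⟨hκ, hj⟩, ⟨⟨hxD, hgap⟩, hxO⟩, ⟨hxD, h1⟩, hxD, h2⟩
    · rintro ⟨κ, ⟨hκ, hj⟩, ⟨⟨hxD, hgap⟩, hxO⟩, ⟨-, h1⟩, -, h2⟩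
      exact ⟨hxD, hgap, κ, hκ, hj, hxO, h1, h2⟩
  rw [h]
  refine IsSemialgebraic.biUnion _ _ fun κ hκ => ?_
  have hκ𝒦 : κ ∈ F.𝒦 := by
    have := (Finset.mem_filter.1 hκ).1
    exact S.𝒦_fin.mem_toFinset.1 this
  exact ((LensFamilies.sa_sep_lt' (α_sa S k) (α_sa S (k + 1))).inter (S.O_sa κ hκ𝒦)).inter
    ((LensFamilies.sa_sep_le (lo_sa S H hκ𝒦) (α_sa S k)).inter (LensFamilies.sa_sep_le (α_sa S (k + 1)) (hi_sa S H hκ𝒦)))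

/-- `dR_{k,j}` is semialgebraic. [cite: BochnakCosteRoy1998, Prop. 2.2.8] -/
theorem dR_sa (k : ℕ) (j : Fin q) : IsSemialgebraicFunOn ℝ univ (F.dR k j) := by
  unfold dR; split_ifs
  · exact isSemialgebraicFunOn_infDist (S.D_sa.diff (R_sa H S k j))
  · exact isSemialgebraicFunOn_const' isSemialgebraic_univ 1

/-- **`cc_{k,j}` is semialgebraic on `D`.** [cite: Pawlucki2024, Prop. 2.5] -/
theorem cc_sa (k j : ℕ) : IsSemialgebraicFunOn ℝ F.D (F.cc k j) := by
  classical
  have hD := S.D_sa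
  have hdR : ∀ j', IsSemialgebraicFunOn ℝ F.D (F.dR k j') := fun j' => (dR_sa H S k j').mono (subset_univ _) hD
  have hsR : IsSemialgebraicFunOn ℝ F.D (F.sR k) := by
    unfold sR; exact IsSemialgebraicFunOn.finset_sum hD _ fun j' _ => hdR j'
  have hΛ : IsSemialgebraicFunOn ℝ F.D (F.Λ k j) := by
    unfold Λ
    exact IsSemialgebraicFunOn.div₀ hD (IsSemialgebraicFunOn.finset_sum hD _ fun j' _ => hdR j') hsR
  have hcl : IsSemialgebraicFunOn ℝ F.D (fun x => clamp01 (F.Λ k j x)) := by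
    unfold clamp01
    exact IsSemialgebraicFunOn.max hD (isSemialgebraicFunOn_const' hD 0)
      (IsSemialgebraicFunOn.min hD hΛ (isSemialgebraicFunOn_const' hD 1))
  unfold cc
  exact IsSemialgebraicFunOn.add_holds (α_sa S k)
    (IsSemialgebraicFunOn.mul_holds hcl (IsSemialgebraicFunOn.sub_holds (α_sa S (k + 1)) (α_sa S k)))

/-! #### The indexed laminar family -/

omit S in
/-- **Index-level witnesses** [Pawlucki2024, Prop. 2.5 with Remark 2.3, in the form used by
Lemma 5.1]: a continuous semialgebraic laminar family `a = β₀ ≤ β₁ ≤ ⋯ ≤ β_r = b` on `D` refining the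
sorted family, together with a member `V (jw n)` of the cover for EVERY index `n` containing all the
nonempty open fibres of the `n`-th piece. [cite: Pawlucki2024, Prop. 2.5, Remark 2.3, Lemma 5.1] -/
theorem exists_indexed_laminar (S : F.SA) : ∃ (r : ℕ) (β : ℕ → (Fin m → ℝ) → ℝ) (jw : ℕ → Fin q),
    (∀ n, ContinuousOn (β n) F.D) ∧ (∀ n, IsSemialgebraicFunOn ℝ F.D (β n)) ∧
    (∀ x ∈ F.D, Monotone fun n => β n x) ∧ (∀ x ∈ F.D, β 0 x = F.a x) ∧
    (∀ x ∈ F.D, ∀ n, r ≤ n → β n x = F.b x) ∧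
    (∀ n, ∀ x ∈ F.D, F.α (n / q) x ≤ β n x ∧ β (n + 1) x ≤ F.α (n / q + 1) x) ∧
    ∀ n, ∀ x ∈ F.D, β n x < β (n + 1) x →
      ∀ t ∈ Ioo (β n x) (β (n + 1) x), (Fin.snoc x t : Fin (m + 1) → ℝ) ∈ F.V (jw n) := by
  have hq := H.q_pos
  set β : ℕ → (Fin m → ℝ) → ℝ := fun n => F.cc (n / q) (n % q) with hβ
  -- the successor formula
  have hsucc : ∀ n, ∀ x ∈ F.D, β (n + 1) x = F.cc (n / q) (n % q + 1) x := by
    intro n x hx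
    have hn := Nat.div_add_mod n q
    set k := n / q
    set j := n % q
    have hj : j < q := Nat.mod_lt n hq
    by_cases hj1 : j + 1 < q
    · have e : n + 1 = q * k + (j + 1) := by omega
      show F.cc ((n + 1) / q) ((n + 1) % q) x = F.cc k (j + 1) x
      rw [e, Nat.mul_add_div hq, Nat.mul_add_mod, Nat.div_eq_of_lt hj1, Nat.mod_eq_of_lt hj1, add_zero]
    · have hjq : j + 1 = q := by omega
      have e : n + 1 = q * (k + 1) + 0 := by rw [mul_add, mul_one, add_zero]; omega
      show F.cc ((n + 1) / q) ((n + 1) % q) x = F.cc k (j + 1) x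
      rw [e, Nat.mul_add_div hq, Nat.mul_add_mod, Nat.zero_div, Nat.zero_mod, add_zero, cc_zero, hjq, cc_top H hx]
  refine ⟨q * (F.N + 1), β, fun n => ⟨n % q, Nat.mod_lt n hq⟩, fun n => continuousOn_cc H _ _,
    fun n => cc_sa H S _ _, fun x hx => ?_, fun x hx => ?_, fun x hx n hn => ?_, fun n x hx => ?_, fun n x hx hlt t ht => ?_⟩
  · -- monotone
    refine monotone_nat_of_le_succ fun n => ?_
    show β n x ≤ β (n + 1) x
    rw [hsucc n x hx]
    exact cc_mono_j H hx _ (Nat.le_succ _)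
  · show F.cc (0 / q) (0 % q) x = F.a x
    rw [Nat.zero_div, Nat.zero_mod, cc_zero]; exact α_zero H hx
  · have hk : F.N + 1 ≤ n / q := (Nat.le_div_iff_mul_le hq).2 (by rw [mul_comm]; exact hn)
    have h1 : F.α (n / q) x = F.b x := α_last H hx hk
    have h2 : F.α (n / q + 1) x = F.b x := α_last H hx (by omega)
    have h := cc_mem H hx (n / q) (n % q)
    rw [h1, h2] at h
    exact le_antisymm h.2 h.1
  · refine ⟨(cc_mem H hx _ _).1, ?_⟩
    rw [hsucc n x hx]; exact (cc_mem H hx _ _).2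
  · rw [hsucc n x hx] at hlt ht
    obtain ⟨-, -, κ, hκ, hj, hxO, h1, h2⟩ := mem_R_of_cc_lt H hx (Nat.mod_lt n hq) hlt
    have hmem : t ∈ Ioo (κ.lo x) (κ.hi x) :=
      ⟨h1.trans_lt ((cc_mem H hx _ _).1.trans_lt ht.1), (ht.2.trans_le (cc_mem H hx _ _).2).trans_le h2⟩
    have h := (H.good κ hκ).2 x hxO t hmem
    rw [hj] at h
    exact h

end CertFamily

end Extraction

end Literature.ModelTheory.ExponentialFields
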